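import Literature.NumberTheory.EllipticCurves.IsogenyTwoPowerQuotientProofs
import HarnessLib

/-!
# Crux `MazurKenkuBound` (stmt-ABC-15125), line `radius-lite` — stub `stub_twoStep`:
# one step down the chain of `2`-isogenies

On an elliptic curve `W : y² = x³ + ax² + d²x` over `ℚ` (two-torsion normal form, `T = (0, 0)`),
let `C ⊆ W(ℚ̄)` be a `Γ_ℚ`-stable cyclic subgroup of order `2ᵏ`, `k ≥ 2`, whose element of order
`2` is `T`. Silverman's explicit `2`-isogeny `φ : W → V`, `V : Y² = X³ − 2aX² + (a² − 4d²)X`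
(*AEC*, III.4 Example 4.5; the tree's `WeierstrassCurve.twoIsogeny`, kernel `{O, T}`) carries
`C` onto `C₁ := φ(C)`, a `Γ_ℚ`-stable cyclic subgroup of `V(ℚ̄)` of order `2ᵏ⁻¹`
(`#C = #ker φ · #φ(C)` as `ker φ = {O, T} ≤ C`). Its element of order `2` is `φ(Q)` for any
`Q ∈ C` with `2Q = T`: such a `Q = (x, y)` has `x² = d²` (duplication formula), so `x = e = ±d`
and `φ(Q) = ((x² + ax + d²)/x, y(x² − d²)/x²) = (a + 2e, 0)` — one of the two `2`-torsion points
of `V` other than `(0, 0)`. The shift `x ↦ x + (a + 2e)` (the change of variables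
`(1, a + 2e, 0, 0)`, an isomorphism over `ℚ`) moves it to the origin of
`y² = x³ + (a + 6e)x² + 4e(a + 2e)x`, on which the image of `C₁` is the required chain datum of
order `2ᵏ⁻¹`.

## References

* [SilvermanAEC2009] J. H. Silverman, *The Arithmetic of Elliptic Curves*, 2nd ed., GTM 106
  (2009), III.2.3 (d) (duplication formula), III.4 Example 4.5 (the `2`-isogeny and its
  kernel), III.1 Table 3.1 and III.3.1 (b) (changes of variables), X.4.9.
-/

-- `Summit.ABC.ABC` is the mandated summit-side namespace (CONVENTIONS §2); the duplicate is deliberate.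
set_option linter.dupNamespace false

noncomputable section

open scoped Classical
open WeierstrassCurve
open Literature.NumberTheory.EllipticCurves

namespace Summit.ABC.ABC.Theorems

universe u

section General

variable {K : Type u} [Field K]

/-- On `y² = x³ + ax² + bx` (two-torsion normal form, elliptic), an affine point `P` with
`P + P = T = (0, 0)` is `(x, y)` with `x ≠ 0` and `x² = b` (duplication formula
`x(2P) · (2y)² = (x² − b)²` with `x(2P) = 0`). [cite: SilvermanAEC2009, III.2.3 (d)] -/
private theorem exists_eq_some_of_add_self_eq_twoTorsionPoint {F : Type*} [Field F]
    (W : WeierstrassCurve F) [W.IsTwoTorsionNF] [W.IsElliptic] {P : W.toAffine.Point}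
    (hP : P + P = W.twoTorsionPoint) :
    ∃ (x y : F) (h : W.toAffine.Nonsingular x y), P = .some x y h ∧ x ≠ 0 ∧ x ^ 2 = W.a₄ := by
  rcases P with _ | ⟨x, y, h⟩
  · rw [← Affine.Point.zero_def, add_zero] at hP
    exact absurd hP.symm (Affine.Point.some_ne_zero _)
  · have hy : y ≠ W.toAffine.negY x y := by
      intro hy
      rw [Affine.Point.add_self_of_Y_eq hy] at hP
      exact Affine.Point.some_ne_zero _ hP.symm
    have key := addX_self_mul W h hy
    rw [Affine.Point.add_self_of_Y_ne hy, twoTorsionPoint, Affine.Point.some.injEq] at hP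
    rw [hP.1, zero_mul] at key
    have hxb : x ^ 2 = W.a₄ := sub_eq_zero.mp ((pow_eq_zero_iff two_ne_zero).mp key.symm)
    refine ⟨x, y, h, rfl, ?_, hxb⟩
    rintro rfl
    apply a₄_ne_zero W
    rw [← hxb]
    ring

/-- The `2`-isogeny on a point `Q` with `2Q = T`: `Q = (x, y)` with `x² = b`, and
`φ(Q) = ((x² + ax + b)/x, y(x² − b)/x²) = (a + 2x, 0)`.
[cite: SilvermanAEC2009, III.4 Example 4.5] -/
private theorem twoIsogeny_eq_some_of_two_nsmul_eq (V : WeierstrassCurve K) [V.IsTwoTorsionNF]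
    [V.IsElliptic] {Q : V.geomPoints} (hQ : 2 • Q = V.geomTwoTorsionPoint) :
    ∃ (x : AlgebraicClosure K)
      (h' : (V.twoIsogenyCodomain.baseChange (AlgebraicClosure K)).toAffine.Nonsingular
        (algebraMap K (AlgebraicClosure K) V.a₂ + 2 * x) 0),
      x ^ 2 = algebraMap K (AlgebraicClosure K) V.a₄ ∧
        V.twoIsogeny Q = (Affine.Point.some _ _ h' : V.twoIsogenyCodomain.geomPoints) := by
  obtain ⟨x, y, h, hQe, hx, hxb⟩ := exists_eq_some_of_add_self_eq_twoTorsionPoint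
    (V.baseChange (AlgebraicClosure K)) (P := Q) (by rw [← two_nsmul]; exact hQ)
  obtain ⟨h₁, e₁⟩ := twoIsogenyGeomHom_some V h hx
  have hb : (V.baseChange (AlgebraicClosure K)).a₄ = algebraMap K (AlgebraicClosure K) V.a₄ := by
    simp [baseChange]
  have ha : (V.baseChange (AlgebraicClosure K)).a₂ = algebraMap K (AlgebraicClosure K) V.a₂ := by
    simp [baseChange]
  have hX : (V.baseChange (AlgebraicClosure K)).twoIsogenyX x =
      algebraMap K (AlgebraicClosure K) V.a₂ + 2 * x := by
    rw [twoIsogenyX, ← hxb, ← ha, div_eq_iff hx]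
    ring
  have hY : (V.baseChange (AlgebraicClosure K)).twoIsogenyY x y = 0 := by
    rw [twoIsogenyY, ← hxb, sub_self, mul_zero, zero_div]
  obtain ⟨h₂, e₂⟩ := some_eq_some_of_eq h₁ hX hY
  refine ⟨x, h₂, hxb.trans hb, ?_⟩
  rw [hQe, twoIsogeny_apply, e₁]
  exact e₂

/-- `#C = #ker f · #f(C)` for a subgroup `C ⊇ ker f` (first isomorphism theorem, as a tower of
relative indices `⊥ ≤ ker f ≤ C`). [folklore] -/
private theorem card_eq_card_ker_mul_card_map {A B : Type*} [AddGroup A] [AddGroup B]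
    (f : A →+ B) {C : AddSubgroup A} (hC : f.ker ≤ C) :
    Nat.card C = Nat.card f.ker * Nat.card (C.map f) := by
  have h := AddSubgroup.relIndex_mul_relIndex ⊥ f.ker C bot_le hC
  rw [AddSubgroup.relIndex_bot_left, AddSubgroup.relIndex_bot_left,
    AddSubgroup.relIndex_ker] at h
  exact h.symm

/-- **The image of the chain datum under the `2`-isogeny.** On `V : y² = x³ + ax² + bx`
(elliptic), let `C ⊆ V(K̄)` be `Γ_K`-stable, cyclic of order `2ᵏ`, `k ≥ 2`, with `T = (0,0)` its
only element of order `2`. Then `C` contains a point `Q` with `2Q = T` (`Q = 2ᵏ⁻²g` for a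
generator `g`), and `φ(C)` (`φ = twoIsogeny`, kernel `{O, T} ⊆ C`) is `Γ_K`-stable (`φ` is
defined over `K`), cyclic, of order `2ᵏ / 2`, and its nonzero elements killed by `2` all equal
`φ(Q)`: `φ(R)` with `2φ(R) = O` has `2R ∈ {O, T}`, `2R = O` forces `R ∈ {O, T} = ker φ`, and
`2R = T` forces `R − Q ∈ {O, T}`, `φ(R) = φ(Q)`. [cite: SilvermanAEC2009, III.4 Example 4.5] -/
private theorem twoIsogeny_map_chain (V : WeierstrassCurve K) [V.IsTwoTorsionNF] [V.IsElliptic]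
    (C : AddSubgroup V.geomPoints) {k : ℕ} (hk : 2 ≤ k)
    (hst : ∀ σ : Field.absoluteGaloisGroup K, ∀ P ∈ C, σ • P ∈ C) (hcyc : IsAddCyclic C)
    (hcard : Nat.card C = 2 ^ k)
    (h2 : ∀ P ∈ C, 2 • P = 0 → P ≠ 0 → P = V.geomTwoTorsionPoint) :
    ∃ Q ∈ C, 2 • Q = V.geomTwoTorsionPoint ∧
      (∀ σ : Field.absoluteGaloisGroup K, ∀ P ∈ C.map V.twoIsogeny.toAddMonoidHom,
          σ • P ∈ C.map V.twoIsogeny.toAddMonoidHom) ∧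
      IsAddCyclic (C.map V.twoIsogeny.toAddMonoidHom) ∧
      Nat.card (C.map V.twoIsogeny.toAddMonoidHom) = 2 ^ (k - 1) ∧
      ∀ P ∈ C.map V.twoIsogeny.toAddMonoidHom, 2 • P = 0 → P ≠ 0 → P = V.twoIsogeny Q := by
  -- a point `Q ∈ C` with `4Q = O`, `2Q ≠ O`, so that `2Q = T ∈ C`
  obtain ⟨Q, hQC, h4Q, h2Q0⟩ : ∃ Q ∈ C, 2 • (2 • Q) = 0 ∧ 2 • Q ≠ 0 := by
    obtain ⟨g, hg⟩ := IsAddCyclic.exists_ofOrder_eq_natCard (α := C)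
    rw [hcard, ← AddSubgroup.addOrderOf_coe] at hg
    refine ⟨2 ^ (k - 2) • (g : V.geomPoints), C.nsmul_mem g.2 _, ?_, ?_⟩
    · have e : 2 * 2 * 2 ^ (k - 2) = 2 ^ k := by
        rw [mul_assoc, ← pow_succ', ← pow_succ', show k - 2 + 1 + 1 = k by omega]
      rw [smul_smul, smul_smul, e, ← hg]
      exact addOrderOf_nsmul_eq_zero _
    · intro h0
      rw [smul_smul, ← pow_succ'] at h0
      have hdvd := addOrderOf_dvd_of_nsmul_eq_zero h0
      rw [hg, Nat.pow_dvd_pow_iff_le_right Nat.one_lt_two] at hdvd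
      omega
  have hT : 2 • Q = V.geomTwoTorsionPoint := h2 _ (C.nsmul_mem hQC 2) h4Q h2Q0
  have hTC : V.geomTwoTorsionPoint ∈ C := hT ▸ C.nsmul_mem hQC 2
  set f := V.twoIsogeny.toAddMonoidHom
  have hker : ∀ P, f P = 0 ↔ P = 0 ∨ P = V.geomTwoTorsionPoint := fun P ↦
    (mem_ker_twoIsogenyGeomHom_iff V P)
  refine ⟨Q, hQC, hT, ?_, ?_, ?_, ?_⟩
  · -- stability: `φ` commutes with `Γ_K`
    intro σ P hP
    obtain ⟨R, hR, rfl⟩ := AddSubgroup.mem_map.mp hP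
    exact AddSubgroup.mem_map.mpr ⟨σ • R, hst σ R hR, V.twoIsogeny.map_smul σ R⟩
  · -- cyclicity: a quotient of a cyclic group
    haveI := hcyc
    exact isAddCyclic_of_surjective (f.addSubgroupMap C) (f.addSubgroupMap_surjective C)
  · -- order: `#C = #ker φ · #φ(C)` with `#ker φ = 2`
    have hle : f.ker ≤ C := by
      intro P hP
      rcases (mem_ker_twoIsogenyGeomHom_iff V P).mp hP with rfl | rfl
      exacts [C.zero_mem, hTC]
    have hdeg : Nat.card f.ker = 2 := degree_twoIsogeny V
    have h := card_eq_card_ker_mul_card_map f hle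
    rw [hcard, hdeg, show k = k - 1 + 1 by omega, pow_succ'] at h
    exact (Nat.eq_of_mul_eq_mul_left two_pos h).symm
  · -- the elements of order `2` of `φ(C)`
    intro P hP h2P hP0
    obtain ⟨R, hR, rfl⟩ := AddSubgroup.mem_map.mp hP
    have hR0 : R ≠ 0 := by
      rintro rfl
      exact hP0 (map_zero f)
    have h2R : f (2 • R) = 0 := by rw [map_nsmul, h2P]
    rcases (hker _).mp h2R with h0 | h1
    · exact absurd ((hker _).mpr (Or.inr (h2 R hR h0 hR0))) hP0
    · have hD : 2 • (R - Q) = 0 := by rw [nsmul_sub, h1, hT, sub_self]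
      by_cases hD0 : R - Q = 0
      · rw [sub_eq_zero.mp hD0]
        rfl
      · have hDT := h2 _ (C.sub_mem hR hQC) hD hD0
        rw [sub_eq_iff_eq_add] at hDT
        rw [hDT, map_add, (hker _).mpr (Or.inr rfl), zero_add]
        rfl

/-- **Transport of the chain datum along the shift `x ↦ x + r`.** For the change of variables
`Cₛ = (1, r, 0, 0)` over `K` and `V' = Cₛ • V` (in two-torsion normal form, elliptic), a
`Γ_K`-stable cyclic subgroup `C₁ ⊆ V(K̄)` of order `2ᵐ` whose nonzero elements killed by `2`
are all the point `(r, 0)` is carried by the `K`-isomorphism `V ≅ V'`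
(`VariableChange.toIsogeny`, `(x, y) ↦ (x − r, y)`) to such a subgroup of `V'(K̄)` whose element
of order `2` is `(0, 0)`. [cite: SilvermanAEC2009, III.1 Table 3.1] -/
private theorem shift_chain {V V' : WeierstrassCurve K} [V'.IsTwoTorsionNF] [V'.IsElliptic]
    (r : K) (hV : (⟨1, r, 0, 0⟩ : VariableChange K) • V = V') (C₁ : AddSubgroup V.geomPoints)
    {m : ℕ} (hst : ∀ σ : Field.absoluteGaloisGroup K, ∀ P ∈ C₁, σ • P ∈ C₁)
    (hcyc : IsAddCyclic C₁) (hcard : Nat.card C₁ = 2 ^ m)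
    (h2 : ∀ P ∈ C₁, 2 • P = 0 → P ≠ 0 →
      ∃ h, P = (Affine.Point.some (algebraMap K (AlgebraicClosure K) r) 0 h : V.geomPoints)) :
    ∃ C' : AddSubgroup V'.geomPoints,
      (∀ σ : Field.absoluteGaloisGroup K, ∀ P ∈ C', σ • P ∈ C') ∧ IsAddCyclic C' ∧
        Nat.card C' = 2 ^ m ∧ ∀ P ∈ C', 2 • P = 0 → P ≠ 0 → P = V'.geomTwoTorsionPoint := by
  subst hV
  set Cs : VariableChange K := ⟨1, r, 0, 0⟩ with hCs
  have hinj := VariableChange.toIsogeny_injective V Cs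
  refine ⟨C₁.map (VariableChange.toIsogeny V Cs).toAddMonoidHom, ?_, ?_, ?_, ?_⟩
  · intro σ P hP
    obtain ⟨R, hR, rfl⟩ := AddSubgroup.mem_map.mp hP
    exact AddSubgroup.mem_map.mpr
      ⟨σ • R, hst σ R hR, (VariableChange.toIsogeny V Cs).map_smul σ R⟩
  · haveI := hcyc
    exact isAddCyclic_of_surjective
      ((VariableChange.toIsogeny V Cs).toAddMonoidHom.addSubgroupMap C₁)
      ((VariableChange.toIsogeny V Cs).toAddMonoidHom.addSubgroupMap_surjective C₁)
  · rw [← hcard]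
    exact Nat.card_congr
      (C₁.equivMapOfInjective (VariableChange.toIsogeny V Cs).toAddMonoidHom hinj).toEquiv.symm
  · intro P hP h2P hP0
    obtain ⟨R, hR, rfl⟩ := AddSubgroup.mem_map.mp hP
    have h2R : 2 • R = 0 := hinj (by rw [map_nsmul, map_zero]; exact h2P)
    have hR0 : R ≠ 0 := by
      rintro rfl
      exact hP0 (map_zero _)
    obtain ⟨h, rfl⟩ := h2 R hR h2R hR0
    show VariableChange.toIsogeny V Cs _ = _
    rw [VariableChange.toIsogeny_some]
    have hx : (Cs.map (algebraMap K (AlgebraicClosure K))).toX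
        (algebraMap K (AlgebraicClosure K) r) = 0 := by
      simp [hCs, VariableChange.toX_def, VariableChange.map]
    have hy : (Cs.map (algebraMap K (AlgebraicClosure K))).toY
        (algebraMap K (AlgebraicClosure K) r) 0 = 0 := by
      simp [hCs, VariableChange.toY_def, VariableChange.map]
    obtain ⟨h', e'⟩ := UnivEC.some_eq_some_of_eq hx hy
      ((VariableChange.baseChange_smul_eq V Cs (AlgebraicClosure K)) ▸
        (VariableChange.nonsingular_iff (V.baseChange (AlgebraicClosure K))
          (Cs.map (algebraMap K (AlgebraicClosure K))) _ _).mpr h)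
    exact e'

end General

/-- The shift `x ↦ x + (a + 2e)`, `e = ±d`, of `Y² = X³ − 2aX² + (a² − 4d²)X` is
`y² = x³ + (a + 6e)x² + 4e(a + 2e)x` (Silverman's Table 3.1 with `u = 1`, `r = a + 2e`,
`s = t = 0`, and `e² = d²`). [cite: SilvermanAEC2009, III.1 Table 3.1] -/
private theorem shift_twoIsogenyCodomain_eq {a d e : ℚ} (he : e = d ∨ e = -d) :
    (⟨1, a + 2 * e, 0, 0⟩ : VariableChange ℚ) •
        (⟨0, a, 0, d ^ 2, 0⟩ : WeierstrassCurve ℚ).twoIsogenyCodomain =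
      ⟨0, a + 6 * e, 0, 4 * e * (a + 2 * e), 0⟩ := by
  have he2 : e ^ 2 = d ^ 2 := by rcases he with rfl | rfl <;> ring
  ext
  · simp [variableChange_a₁, twoIsogenyCodomain]
  · simp only [variableChange_a₂, twoIsogenyCodomain, Units.val_one, inv_one, one_pow, one_mul]
    ring
  · simp [variableChange_a₃, twoIsogenyCodomain]
  · simp only [variableChange_a₄, twoIsogenyCodomain, Units.val_one, inv_one, one_pow, one_mul]
    linear_combination (4 : ℚ) * he2
  · simp only [variableChange_a₆, twoIsogenyCodomain, Units.val_one, inv_one, one_pow, one_mul]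
    linear_combination (4 * (a + 2 * e)) * he2

/-- STUB 10 (one step down the chain): on an elliptic `y² = x³ + ax² + d²x` over `ℚ`, a
`Γ_ℚ`-stable cyclic `C` of order `2ᵏ`, `k ≥ 2`, with `C[2] = ⟨(0,0)⟩` is carried by Silverman's
`2`-isogeny (`twoIsogeny`, kernel `{O, (0,0)}`; codomain `Y² = X³ − 2aX² + (a² − 4d²)X`) onto a
stable cyclic group of order `2ᵏ⁻¹` whose `2`-torsion point is `φ(Q) = (a + 2e, 0)`, `2Q = T`,
`e = x(Q) = ±d`; the shift `x ↦ x + (a + 2e)` puts it at the origin of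
`y² = x³ + (a + 6e)x² + 4e(a + 2e)x`. [cite: SilvermanAEC2009, III.4 Example 4.5] -/
theorem stub_twoStep :
    ∀ (a d : ℚ) [(⟨0, a, 0, d ^ 2, 0⟩ : WeierstrassCurve ℚ).IsElliptic]
      (C : AddSubgroup (⟨0, a, 0, d ^ 2, 0⟩ : WeierstrassCurve ℚ).geomPoints) (k : ℕ), 2 ≤ k →
      (∀ σ : Field.absoluteGaloisGroup ℚ, ∀ P ∈ C, σ • P ∈ C) → IsAddCyclic C → Nat.card C = 2 ^ k →
      (∀ P ∈ C, 2 • P = 0 → P ≠ 0 →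
        P = (⟨0, a, 0, d ^ 2, 0⟩ : WeierstrassCurve ℚ).geomTwoTorsionPoint) →
      ∃ e : ℚ, (e = d ∨ e = -d) ∧
        ∃ (_ : (⟨0, a + 6 * e, 0, 4 * e * (a + 2 * e), 0⟩ : WeierstrassCurve ℚ).IsElliptic)
          (C' : AddSubgroup
            (⟨0, a + 6 * e, 0, 4 * e * (a + 2 * e), 0⟩ : WeierstrassCurve ℚ).geomPoints),
          (∀ σ : Field.absoluteGaloisGroup ℚ, ∀ P ∈ C', σ • P ∈ C') ∧ IsAddCyclic C' ∧
            Nat.card C' = 2 ^ (k - 1) ∧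
            ∀ P ∈ C', 2 • P = 0 → P ≠ 0 →
              P = (⟨0, a + 6 * e, 0, 4 * e * (a + 2 * e), 0⟩ :
                WeierstrassCurve ℚ).geomTwoTorsionPoint := by
  intro a d _ C k hk hst hcyc hcard h2
  -- the image `C₁ = φ(C)` on `V = ⟨0, -2a, 0, a² - 4d², 0⟩` and a point `Q ∈ C` with `2Q = T`
  obtain ⟨Q, -, hT, hst₁, hcyc₁, hcard₁, h2₁⟩ :=
    twoIsogeny_map_chain (⟨0, a, 0, d ^ 2, 0⟩ : WeierstrassCurve ℚ) C hk hst hcyc hcard h2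
  -- `φ(Q) = (a + 2x, 0)` with `x² = d²`, so `x = e = ±d`
  obtain ⟨x, h', hx2, hφQ⟩ :=
    twoIsogeny_eq_some_of_two_nsmul_eq (⟨0, a, 0, d ^ 2, 0⟩ : WeierstrassCurve ℚ) hT
  obtain ⟨e, he, hxe⟩ : ∃ e : ℚ, (e = d ∨ e = -d) ∧ x = algebraMap ℚ (AlgebraicClosure ℚ) e := by
    have hx : x ^ 2 = (algebraMap ℚ (AlgebraicClosure ℚ) d) ^ 2 := by
      rw [← map_pow]
      exact hx2
    rcases sq_eq_sq_iff_eq_or_eq_neg.mp hx with h | h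
    · exact ⟨d, Or.inl rfl, h⟩
    · exact ⟨-d, Or.inr rfl, by rw [map_neg]; exact h⟩
  subst hxe
  have hr : algebraMap ℚ (AlgebraicClosure ℚ) a + 2 * algebraMap ℚ (AlgebraicClosure ℚ) e =
      algebraMap ℚ (AlgebraicClosure ℚ) (a + 2 * e) := by
    rw [map_add, map_mul, map_ofNat]
  obtain ⟨h'', e''⟩ := some_eq_some_of_eq h' hr rfl
  -- the shift `x ↦ x + (a + 2e)`
  have hV := shift_twoIsogenyCodomain_eq (a := a) he
  haveI hE' : (⟨0, a + 6 * e, 0, 4 * e * (a + 2 * e), 0⟩ : WeierstrassCurve ℚ).IsElliptic := by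
    rw [← hV]
    infer_instance
  obtain ⟨C', hst', hcyc', hcard', h2'⟩ := shift_chain (a + 2 * e) hV _ hst₁ hcyc₁ hcard₁
    (fun P hP h2P hP0 ↦ ⟨h'', (h2₁ P hP h2P hP0).trans (hφQ.trans e'')⟩)
  exact ⟨e, he, hE', C', hst', hcyc', hcard', h2'⟩

end Summit.ABC.ABC.Theorems

end
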